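import Mathlib
import HarnessLib
import Literature.Analysis.ValidatedNumerics.IntervalLogArctan
import Summits.KontsevichZagierPeriods.Zeta5Search.Denom.RungALineCertificate
import Summits.KontsevichZagierPeriods.Zeta5Search.TwoTaleD1LineProfileShape

/-!
# Two-point tangent certificate for the D1 = L(1/3) tale-1 line profile (D1 decay, one-variable side)

HONEST FRAMING: systematic search; no irrationality claim unless certified.  This file proves an
inequality about an explicit elementary function of one real variable; no statement about
`ζ(2)`, `ζ(5)` or any linear form is made here.  Cell pub-zeta5 (P1 g12, file T5 of fam-denom's
`families/denom/D1-DESIGN-NOTE.md`); it is the D1 twin of fam-denom's `Denom/RungALineCertificate`,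
whose GENERIC leg evaluators (`legA10`, `legG10`, `sumA10`, `sumG10`, `realA10`, `realG10` and their
soundness lemmas — abscissae `p/10`) are reused verbatim, as are the P15 file's scale `sc = 2^56`, term
counts `KL`, `KA` and `mem_zero` (kernel interval engine `Literature.Analysis.ValidatedNumerics`).
With `PD = profileD1 (15/2)` and `DD = angleD1 (15/2) − 2π` (`TwoTaleD1LineProfileShape.lean`), the
two-point lemma `twoPointD` reduces `sup_{η>0} PD ≤ c` to three facts at two rational points, certified
at `η₁ = 30785/10000 = 3.0785`, `η₂ = 30790/10000 = 3.0790` (design optimum `η* = 3.07875`):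
the legs `legsD1` (`105, 85, 75, 55, 45, 25 ∣ −295, +135` tenths), the constant enclosure `constGD1`
of `16 log 16 − 19 log 19 − 13 log 13 − 7 log 7 + 23`, the Boolean test `certCheckD1`
(`certCheckD1_eq : certCheckD1 = true` by `decide +kernel`) and its soundness `certCheckD1_sound`, giving
* `profileD1_le : η ≠ 0 → profileD1 (15/2) η ≤ −42.33438` (design supremum `−42.3343826` on this line,
  saddle value `−42.33438300`; two-point bound `−42.3343825`), and the certificate WITH SLACK
* `certD1_delta : 0 ≤ δ → δ ≤ 4 → η ≠ 0 → profileD10 (15/2) η − (2π − δ)|η| ≤ −42.33438 + 19 δ`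
  (concavity on `(0, 19]` and the tail slope `PD_tail`),
the one-variable input of the D1 decay `DecayD1 c`, `c < 42.33438` (`TwoTaleD1Decay`).  Design numerics:
`HOME/code/p1/g12/d1_cert_design.py`.  Nothing here is conjectural.
-/

noncomputable section

open Real Set

namespace Summit.KontsevichZagierPeriods.Zeta5Search.TwoTaleD1LineCertificate

open Summit.KontsevichZagierPeriods.Zeta5Search.Denom.LineProfile
open Summit.KontsevichZagierPeriods.Zeta5Search.TwoTaleD1LineProfileShape
open Summit.KontsevichZagierPeriods.Zeta5Search.Denom.TwoTaleP15LineCertificate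
  (sc sc_pos KL KA mem_zero)
open Summit.KontsevichZagierPeriods.Zeta5Search.Denom.RungALineCertificate
  (legA10 legG10 sumA10 sumG10 realA10 realG10 mem_sumA10 mem_sumG10)
open Literature.Analysis.ValidatedNumerics.NumericsMP

/-- The eight legs `(p, sign)` of the D1 profile at `ξ = 15/2` (abscissae `p/10`:
`21/2, 17/2, 15/2, 11/2, 9/2, 5/2 ∣ −59/2, +27/2`). -/
def legsD1 : List (ℤ × ℤ) :=
  [(105, 1), (85, 1), (75, 1), (55, 1), (45, 1), (25, 1), (295, -1), (135, 1)]

/-- `realA10 η legsD1 = angleD1 (15/2) η = DD η + 2π`. -/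
theorem realA10_legsD1 (η : ℝ) : realA10 η legsD1 = DD η + 2 * Real.pi := by
  rw [DD_eq]
  simp only [realA10, legsD1, numLegsD, denAngleD]
  push_cast
  ring

/-- `realG10 η legsD1 + profileD1Const − 2π|η| = PD η`. -/
theorem realG10_legsD1 (η : ℝ) :
    realG10 η legsD1 + profileD1Const - 2 * Real.pi * |η| = PD η := by
  rw [PD_eq]
  simp only [realG10, legsD1]
  push_cast
  ring

/-- Enclosure of `profileD1Const = 16 log 16 − 19 log 19 − 13 log 13 − 7 log 7 + 23`. -/
def constGD1 : Option MI :=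
  match MI.logNat2 sc KL 16, MI.logNat2 sc KL 19, MI.logNat2 sc KL 13, MI.logNat2 sc KL 7 with
  | some A, some B, some C, some D =>
    some (((((A.mulInt 16).sub (B.mulInt 19)).sub (C.mulInt 13)).sub (D.mulInt 7)).add
      (MI.ofInt sc 23))
  | _, _, _, _ => none

/-- Soundness of `constGD1`. -/
theorem mem_constGD1 {C : MI} (h : constGD1 = some C) : MI.mem sc profileD1Const C := by
  unfold constGD1 at h
  split at h
  · rename_i A B C' D hA hB hC hD
    simp only [Option.some.injEq] at h
    subst h
    have key := MI.mem_add (MI.mem_sub (MI.mem_sub (MI.mem_sub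
      (MI.mem_mulInt (MI.mem_logNat2 sc_pos hA) 16) (MI.mem_mulInt (MI.mem_logNat2 sc_pos hB) 19))
      (MI.mem_mulInt (MI.mem_logNat2 sc_pos hC) 13)) (MI.mem_mulInt (MI.mem_logNat2 sc_pos hD) 7))
      (MI.mem_ofInt sc 23)
    have e : Real.log ((16 : ℕ) : ℝ) * ((16 : ℤ) : ℝ) - Real.log ((19 : ℕ) : ℝ) * ((19 : ℤ) : ℝ)
        - Real.log ((13 : ℕ) : ℝ) * ((13 : ℤ) : ℝ) - Real.log ((7 : ℕ) : ℝ) * ((7 : ℤ) : ℝ)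
        + ((23 : ℤ) : ℝ) = profileD1Const := by
      simp only [profileD1Const]
      push_cast
      ring
    rw [e] at key
    exact key
  · simp at h

/-- `η₁ = 30785/10000 = 3.0785`. -/
def etaOneD1 : MI := MI.ofFrac sc 30785 10000

/-- `η₂ = 30790/10000 = 3.0790`. -/
def etaTwoD1 : MI := MI.ofFrac sc 30790 10000

/-- The kernel test: `DD η₁ ≥ 0`, `DD η₂ ≤ 0`, and
`PD η₁ + DD η₁ (η₂ − η₁) ≤ −42.33438`, as integer inequalities between enclosure ends
(`10000·(PD η₁ + DD η₁·5/10000) = 10000 (G + C) + 5 A1 − 61580 π` with `A1 = DD η₁ + 2π`). -/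
def certCheckD1 : Bool :=
  match MI.pi sc KA with
  | some piI =>
    match sumA10 piI etaOneD1 legsD1, sumA10 piI etaTwoD1 legsD1, sumG10 piI etaOneD1 legsD1,
      constGD1 with
    | some A1, some A2, some G1, some C =>
      decide (2 * piI.hi ≤ A1.lo) && (decide (A2.hi ≤ 2 * piI.lo) &&
        decide (10 ^ 5 * (10000 * (G1.hi + C.hi) + 5 * A1.hi - 61580 * piI.lo)
          ≤ -(4233438 * 10000 * (sc : ℤ))))
    | _, _, _, _ => false
  | none => false

/-- The kernel test passes (kernel evaluation of the interval engine). -/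
theorem certCheckD1_eq : certCheckD1 = true := by
  decide +kernel

/-- Soundness of the kernel test. -/
theorem certCheckD1_sound (h : certCheckD1 = true) :
    0 ≤ DD (30785 / 10000) ∧ DD (30790 / 10000) ≤ 0 ∧
      PD (30785 / 10000) + DD (30785 / 10000) * (30790 / 10000 - 30785 / 10000) ≤ -42.33438 := by
  unfold certCheckD1 at h
  split at h
  · rename_i piI hpiI
    split at h
    · rename_i A1 A2 G1 C hA1 hA2 hG1 hC
      simp only [Bool.and_eq_true, decide_eq_true_eq] at h
      obtain ⟨i1, i2, i3⟩ := h
      have hS : (0 : ℝ) < sc := by exact_mod_cast sc_pos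
      have hpi := MI.mem_pi sc hpiI
      have hE1 : MI.mem sc (30785 / 10000 : ℝ) etaOneD1 := by
        simpa [etaOneD1] using MI.mem_ofFrac sc 30785 (by norm_num : 0 < 10000)
      have hE2 : MI.mem sc (30790 / 10000 : ℝ) etaTwoD1 := by
        simpa [etaTwoD1] using MI.mem_ofFrac sc 30790 (by norm_num : 0 < 10000)
      have mA1 := mem_sumA10 hpi hE1 legsD1 hA1
      have mA2 := mem_sumA10 hpi hE2 legsD1 hA2
      have mG1 := mem_sumG10 hpi hE1 legsD1 hG1
      have mC := mem_constGD1 hC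
      rw [realA10_legsD1] at mA1 mA2
      have c1 : (2 : ℝ) * piI.hi ≤ A1.lo := by exact_mod_cast i1
      have c2 : (A2.hi : ℝ) ≤ 2 * piI.lo := by exact_mod_cast i2
      have c3 : (10 : ℝ) ^ 5 * (10000 * ((G1.hi : ℝ) + C.hi) + 5 * A1.hi - 61580 * piI.lo)
          ≤ -(4233438 * 10000 * (sc : ℝ)) := by
        exact_mod_cast i3
      have eP := realG10_legsD1 (30785 / 10000 : ℝ)
      rw [abs_of_pos (by norm_num : (0 : ℝ) < 30785 / 10000)] at eP
      unfold MI.mem at hpi mA1 mA2 mG1 mC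
      refine ⟨?_, ?_, ?_⟩
      · have key : (2 * Real.pi) * sc ≤ (DD (30785 / 10000) + 2 * Real.pi) * sc := by
          linarith [hpi.2, mA1.1]
        nlinarith [le_of_mul_le_mul_right key hS]
      · have key : (DD (30790 / 10000) + 2 * Real.pi) * sc ≤ (2 * Real.pi) * sc := by
          linarith [hpi.1, mA2.2]
        nlinarith [le_of_mul_le_mul_right key hS]
      · rw [← eP]
        have hD : DD (30785 / 10000) * sc ≤ (A1.hi : ℝ) - 2 * piI.lo := by
          have := mA1.2
          linarith [hpi.1]
        have key : (realG10 (30785 / 10000) legsD1 + profileD1Const - 2 * Real.pi * (30785 / 10000)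
            + DD (30785 / 10000) * (30790 / 10000 - 30785 / 10000)) * sc
            ≤ (-42.33438 : ℝ) * sc := by
          nlinarith [mG1.2, mC.2, hpi.1, hD]
        exact le_of_mul_le_mul_right key hS
    · simp at h
  · simp at h

/-- **The certificate**: `profileD1 (15/2) η ≤ −42.33438` for every `η > 0`. -/
theorem profileD1_le_of_pos {η : ℝ} (hη : 0 < η) : profileD1 (15 / 2) η ≤ -42.33438 := by
  obtain ⟨hD1, hD2, hP⟩ := certCheckD1_sound certCheckD1_eq
  have h := twoPointD (by norm_num) (by norm_num) (by norm_num) hD1 hD2 hη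
  exact h.trans hP

/-- `profileD1 (15/2) η ≤ −42.33438` for every `η ≠ 0` (evenness). -/
theorem profileD1_le {η : ℝ} (hη : η ≠ 0) : profileD1 (15 / 2) η ≤ -42.33438 := by
  rcases lt_or_gt_of_ne hη with h | h
  · rw [← profileD1_neg_eta]
    exact profileD1_le_of_pos (neg_pos.2 h)
  · exact profileD1_le_of_pos h

/-! ## The certificate with slack -/

/-- On `η > 0`: `profileD10 (15/2) η − (2π − δ) η ≤ −42.33438 + 19 δ` for `0 ≤ δ ≤ 4`
(concavity up to `η = 19`, the tail slope `PD_tail` beyond). -/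
theorem certD1_of_pos {δ : ℝ} (hδ0 : 0 ≤ δ) (hδ4 : δ ≤ 4) {η : ℝ} (hη : 0 < η) :
    profileD10 (15 / 2) η - (2 * π - δ) * η ≤ -42.33438 + 19 * δ := by
  have hP : profileD10 (15 / 2) η - (2 * π - δ) * η = PD η + δ * η := by
    simp only [PD, profileD1, abs_of_pos hη]
    ring
  rw [hP]
  rcases le_or_gt η 19 with h19 | h19
  · have h1 : PD η ≤ -42.33438 := profileD1_le_of_pos hη
    nlinarith
  · have ht := PD_tail h19.le
    have h19v : PD 19 ≤ -42.33438 := profileD1_le_of_pos (by norm_num)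
    nlinarith

/-- **The `δ`-certificate**: for `0 ≤ δ ≤ 4` and every `η ≠ 0`,
`profileD10 (15/2) η − (2π − δ)|η| ≤ −42.33438 + 19 δ`. -/
theorem certD1_delta {δ : ℝ} (hδ0 : 0 ≤ δ) (hδ4 : δ ≤ 4) (η : ℝ) (hη : η ≠ 0) :
    profileD10 (15 / 2) η - (2 * π - δ) * |η| ≤ -42.33438 + 19 * δ := by
  rcases lt_or_gt_of_ne hη with h | h
  · have h' : 0 < -η := by linarith
    have hc := certD1_of_pos hδ0 hδ4 h'
    rw [profileD10_neg_eta] at hc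
    rw [abs_of_neg h]
    linarith
  · rw [abs_of_pos h]
    exact certD1_of_pos hδ0 hδ4 h

end Summit.KontsevichZagierPeriods.Zeta5Search.TwoTaleD1LineCertificate

end
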